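import Mathlib.Data.Nat.Choose.Basic
import Mathlib.Algebra.BigOperators.Intervals
import Mathlib.Algebra.Order.BigOperators.Group.Finset
import Mathlib.Tactic
import Summits.CriticalPhenomena.PercolationContinuityZ3.Theorems.PercNearOneGluingNoHeavyLowerTailCoreBlock
import Summits.CriticalPhenomena.PercolationContinuityZ3.Theorems.PercNearOneGluingNoHeavyLowerTailTwoLevel
import Summits.CriticalPhenomena.PercolationContinuityZ3.Theorems.PercNearOneGluingNoHeavyLowerTailLemmaS
import HarnessLib

/-!
# THEOREM U-LC: CONJECTURE U in the log-concave (buffer-dominated) regime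

Support file for the Sahi / Conjecture-P programme of route `PercNearOneGluingNoHeavy`
(`--supports stmt-CriticalPhenomena-4575`, prover prim-l12-p5 gen 28; proof note
`prim-l12-p5/U-STRUCTURE-g28.md` §3).  No definitions, no named facts, no sorries.

Setting (note §0).  `N = M₁ + M₂ + L` fair coins: block `b` has `M_b` coins of the first kind with a
symmetric unimodal weight `w_b ≥ 0` on its head count `x_b`, and `L` buffer coins; the section is `K` heads
in total, `2K + j = N` (`j ≥ 0` the shift below the centre).  With `d_b = 2x_b - M_b` the (unnormalised) tilted
two-block sum with constant `κ` is the TRIPLE SUM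
`T(w₁,w₂) = ∑_{x₁,x₂} C(M₁,x₁)w₁(x₁) C(M₂,x₂)w₂(x₂) C(L,K-x₁-x₂) (κ + d₁d₂)`.
CONJECTURE U (prim-l12-p5 gen 27, OMEGA1-g27 §5.6) says `T(w₁,w₂) ≥ 0` for `κ = M₁M₂(N-j²)₊/(N(N-1))`,
i.e. whenever `κ ≥ 0` and the UNTILTED sum `T(1,1)` is `≥ 0`; it implies TEST(j), CORE(t) and (Ω₁) for all θ.

**THEOREM U-LC** (`u_lc`, note §3): if the two-bump sequence `Φ_j(t) = C(L,t) + C(L,t-j)` is two-point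
log-concave (true iff `j² ≤ L+3`; in the tree for `j = 0, 1`: `TwoLevel.phi_lc2_zero/one`), then for every
`κ ≥ 0` with `T(1,1) ≥ 0` and all symmetric unimodal `w₁, w₂ ≥ 0`: `T(w₁,w₂) ≥ 0`.
Proof: `outer_form` writes `T` as a one-block sum against the other block's `(F, Mo)` (tree `CoreBlock`
notation); `LemmaS.lemma_S` (shell single-crossing from `TwoLevel.tlm_of_lc2`) adds one tilt at a time:
`T(1,1) ≥ 0 ⟹ T(w₁,1) ≥ 0 ⟹ T(w₁,w₂) ≥ 0`; a final `ε`-argument removes the positivity of `w₁`.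
Corollaries: `u_lc_zero`, `u_lc_one` (unconditional for `j ≤ 1`: the tilted versions of TEST(0), TEST(1)
for arbitrary symmetric unimodal tilts).
-/

namespace Summit.CriticalPhenomena.PercolationContinuityZ3.Theorems

namespace ULC

open Finset

/-! ### The triple sum as a one-block sum -/

/-- **Outer form.**  Summing the triple sum over block 1 first produces block 1's `F` and `Mo`
(tree `CoreBlock` notation, buffer attached to block 1) at level `K - x₂`. -/
theorem outer_form (M₁ M₂ L K : ℕ) (κ : ℝ) (w₁ w₂ : ℕ → ℝ) :
    ∑ x₁ ∈ range (M₁ + 1), ∑ x₂ ∈ range (M₂ + 1),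
        (M₁.choose x₁ : ℝ) * w₁ x₁ * ((M₂.choose x₂ : ℝ) * w₂ x₂) *
          (if x₁ + x₂ ≤ K then (L.choose (K - (x₁ + x₂)) : ℝ) else 0) *
          (κ + (2 * (x₁ : ℝ) - M₁) * (2 * (x₂ : ℝ) - M₂)) =
      ∑ x₂ ∈ range (M₂ + 1), (M₂.choose x₂ : ℝ) * w₂ x₂ *
        (if x₂ ≤ K then
          κ * (∑ x₁ ∈ range (M₁ + 1), (M₁.choose x₁ : ℝ) *
              (if x₁ ≤ K - x₂ then (L.choose (K - x₂ - x₁) : ℝ) else 0) * w₁ x₁) +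
          (2 * (x₂ : ℝ) - M₂) * (∑ x₁ ∈ range (M₁ + 1), (M₁.choose x₁ : ℝ) *
              (if x₁ ≤ K - x₂ then (L.choose (K - x₂ - x₁) : ℝ) else 0) * w₁ x₁ * (2 * (x₁ : ℝ) - M₁))
        else 0) := by
  rw [sum_comm]
  refine sum_congr rfl fun x₂ _ => ?_
  by_cases hx₂ : x₂ ≤ K
  · rw [if_pos hx₂, mul_add, ← mul_assoc, ← mul_assoc, mul_sum, mul_sum, ← sum_add_distrib]
    refine sum_congr rfl fun x₁ _ => ?_
    have hg : (if x₁ + x₂ ≤ K then (L.choose (K - (x₁ + x₂)) : ℝ) else 0) =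
        (if x₁ ≤ K - x₂ then (L.choose (K - x₂ - x₁) : ℝ) else 0) := by
      by_cases h : x₁ + x₂ ≤ K
      · rw [if_pos h, if_pos (by omega)]
        have e : K - (x₁ + x₂) = K - x₂ - x₁ := by omega
        rw [e]
      · rw [if_neg h, if_neg (by omega)]
    rw [hg]
    ring
  · rw [if_neg hx₂, mul_zero]
    refine sum_eq_zero fun x₁ _ => ?_
    rw [if_neg (by omega)]
    ring

/-- The triple sum is symmetric under exchanging the two blocks. -/
theorem triple_comm (M₁ M₂ L K : ℕ) (κ : ℝ) (w₁ w₂ : ℕ → ℝ) :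
    ∑ x₁ ∈ range (M₁ + 1), ∑ x₂ ∈ range (M₂ + 1),
        (M₁.choose x₁ : ℝ) * w₁ x₁ * ((M₂.choose x₂ : ℝ) * w₂ x₂) *
          (if x₁ + x₂ ≤ K then (L.choose (K - (x₁ + x₂)) : ℝ) else 0) *
          (κ + (2 * (x₁ : ℝ) - M₁) * (2 * (x₂ : ℝ) - M₂)) =
      ∑ x₂ ∈ range (M₂ + 1), ∑ x₁ ∈ range (M₁ + 1),
        (M₂.choose x₂ : ℝ) * w₂ x₂ * ((M₁.choose x₁ : ℝ) * w₁ x₁) *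
          (if x₂ + x₁ ≤ K then (L.choose (K - (x₂ + x₁)) : ℝ) else 0) *
          (κ + (2 * (x₂ : ℝ) - M₂) * (2 * (x₁ : ℝ) - M₁)) := by
  rw [sum_comm]
  refine sum_congr rfl fun x₂ _ => sum_congr rfl fun x₁ _ => ?_
  have e : x₂ + x₁ = x₁ + x₂ := Nat.add_comm _ _
  rw [e]
  ring

/-! ### One-block facts in `(F, Mo)` form -/

/-- The block weight is strictly positive on `0..M+L` when `w > 0` on `0..M`. -/
theorem F_pos (M L : ℕ) (w : ℕ → ℝ) (hwpos : ∀ x, x ≤ M → 0 < w x) (hwnn : ∀ x, 0 ≤ w x)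
    (k : ℕ) (hk : k ≤ M + L) :
    0 < ∑ x ∈ range (M + 1), (M.choose x : ℝ) *
        (if x ≤ k then (L.choose (k - x) : ℝ) else 0) * w x := by
  -- the term x₀ = k - min k L is positive
  have hterm : ∀ x ∈ range (M + 1), 0 ≤ (M.choose x : ℝ) *
      (if x ≤ k then (L.choose (k - x) : ℝ) else 0) * w x := by
    intro x _
    refine mul_nonneg (mul_nonneg (by positivity) ?_) (hwnn x)
    split_ifs <;> positivity
  set x₀ := k - min k L with hx₀
  have hx₀M : x₀ ≤ M := by omega
  have hx₀k : x₀ ≤ k := by omega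
  have hkx₀ : k - x₀ ≤ L := by omega
  have hmem : x₀ ∈ range (M + 1) := mem_range.mpr (by omega)
  have hpos : 0 < (M.choose x₀ : ℝ) * (if x₀ ≤ k then (L.choose (k - x₀) : ℝ) else 0) * w x₀ := by
    rw [if_pos hx₀k]
    have h1 : 0 < (M.choose x₀ : ℝ) := by exact_mod_cast Nat.choose_pos hx₀M
    have h2 : 0 < (L.choose (k - x₀) : ℝ) := by exact_mod_cast Nat.choose_pos hkx₀
    exact mul_pos (mul_pos h1 h2) (hwpos x₀ hx₀M)
  exact lt_of_lt_of_le hpos (single_le_sum hterm hmem)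

/-- Two-level monotonicity in `(F, Mo)` form (from `TwoLevel.tlm_of_lc2`). -/
theorem tlm_block (M L j : ℕ) (w : ℕ → ℝ) (hwnn : ∀ x, 0 ≤ w x)
    (hlc : ∀ m m', m ≤ m' →
      ((L.choose m : ℝ) + (if j ≤ m then (L.choose (m - j) : ℝ) else 0)) *
        ((L.choose (m' + 1) : ℝ) + (if j ≤ m' + 1 then (L.choose (m' + 1 - j) : ℝ) else 0)) ≤
      ((L.choose (m + 1) : ℝ) + (if j ≤ m + 1 then (L.choose (m + 1 - j) : ℝ) else 0)) *
        ((L.choose m' : ℝ) + (if j ≤ m' then (L.choose (m' - j) : ℝ) else 0)))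
    (b : ℕ) :
    ((∑ x ∈ range (M + 1), (M.choose x : ℝ) * (if x ≤ b then (L.choose (b - x) : ℝ) else 0) * w x *
        (2 * (x : ℝ) - M)) +
      ∑ x ∈ range (M + 1), (M.choose x : ℝ) * (if x ≤ b + j then (L.choose (b + j - x) : ℝ) else 0) *
        w x * (2 * (x : ℝ) - M)) *
    ((∑ x ∈ range (M + 1), (M.choose x : ℝ) * (if x ≤ b + 1 then (L.choose (b + 1 - x) : ℝ) else 0) *
        w x) +
      ∑ x ∈ range (M + 1), (M.choose x : ℝ) *
        (if x ≤ b + 1 + j then (L.choose (b + 1 + j - x) : ℝ) else 0) * w x) ≤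
    ((∑ x ∈ range (M + 1), (M.choose x : ℝ) * (if x ≤ b + 1 then (L.choose (b + 1 - x) : ℝ) else 0) *
        w x * (2 * (x : ℝ) - M)) +
      ∑ x ∈ range (M + 1), (M.choose x : ℝ) *
        (if x ≤ b + 1 + j then (L.choose (b + 1 + j - x) : ℝ) else 0) * w x * (2 * (x : ℝ) - M)) *
    ((∑ x ∈ range (M + 1), (M.choose x : ℝ) * (if x ≤ b then (L.choose (b - x) : ℝ) else 0) * w x) +
      ∑ x ∈ range (M + 1), (M.choose x : ℝ) * (if x ≤ b + j then (L.choose (b + j - x) : ℝ) else 0) *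
        w x) := by
  have h := TwoLevel.tlm_of_lc2 M L j (fun x => (M.choose x : ℝ) * w x)
    (fun x => mul_nonneg (by positivity) (hwnn x)) hlc b
  have e1 : ∀ c : ℕ, (∑ x ∈ range (M + 1), (M.choose x : ℝ) *
        (if x ≤ c then (L.choose (c - x) : ℝ) else 0) * w x * (2 * (x : ℝ) - M)) +
      (∑ x ∈ range (M + 1), (M.choose x : ℝ) *
        (if x ≤ c + j then (L.choose (c + j - x) : ℝ) else 0) * w x * (2 * (x : ℝ) - M)) =
      ∑ x ∈ range (M + 1), (M.choose x : ℝ) * w x * (2 * (x : ℝ) - M) *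
        ((if x ≤ c then (L.choose (c - x) : ℝ) else 0) +
          (if x ≤ c + j then (L.choose (c + j - x) : ℝ) else 0)) := by
    intro c
    rw [← sum_add_distrib]
    refine sum_congr rfl fun x _ => ?_
    ring
  have e2 : ∀ c : ℕ, (∑ x ∈ range (M + 1), (M.choose x : ℝ) *
        (if x ≤ c then (L.choose (c - x) : ℝ) else 0) * w x) +
      (∑ x ∈ range (M + 1), (M.choose x : ℝ) *
        (if x ≤ c + j then (L.choose (c + j - x) : ℝ) else 0) * w x) =
      ∑ x ∈ range (M + 1), (M.choose x : ℝ) * w x *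
        ((if x ≤ c then (L.choose (c - x) : ℝ) else 0) +
          (if x ≤ c + j then (L.choose (c + j - x) : ℝ) else 0)) := by
    intro c
    rw [← sum_add_distrib]
    refine sum_congr rfl fun x _ => ?_
    ring
  rw [e1 b, e1 (b + 1), e2 b, e2 (b + 1)]
  exact h

/-! ### THEOREM U-LC -/

/-- **THEOREM U-LC, positive-weight form.**  Let `2K + j = M₁ + M₂ + L`, `κ ≥ 0`, `w₁ > 0` and `w₂ ≥ 0`
symmetric unimodal weights, and suppose the two-bump sequence `Φ_j(t) = C(L,t) + C(L,t-j)` is two-point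
log-concave.  If the untilted sum `T(1,1)` is nonnegative, so is the tilted sum `T(w₁,w₂)`. -/
theorem u_lc_pos (M₁ M₂ L K j : ℕ) (hN : 2 * K + j = M₁ + M₂ + L) (κ : ℝ) (hκ : 0 ≤ κ)
    (w₁ w₂ : ℕ → ℝ) (hw₁pos : ∀ x, x ≤ M₁ → 0 < w₁ x) (hw₁nn : ∀ x, 0 ≤ w₁ x)
    (hw₁sym : ∀ x, x ≤ M₁ → w₁ x = w₁ (M₁ - x)) (hw₁uni : ∀ x, 2 * x + 2 ≤ M₁ → w₁ x ≤ w₁ (x + 1))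
    (hw₂nn : ∀ x, 0 ≤ w₂ x)
    (hw₂sym : ∀ x, x ≤ M₂ → w₂ x = w₂ (M₂ - x)) (hw₂uni : ∀ x, 2 * x + 2 ≤ M₂ → w₂ x ≤ w₂ (x + 1))
    (hlc : ∀ m m', m ≤ m' →
      ((L.choose m : ℝ) + (if j ≤ m then (L.choose (m - j) : ℝ) else 0)) *
        ((L.choose (m' + 1) : ℝ) + (if j ≤ m' + 1 then (L.choose (m' + 1 - j) : ℝ) else 0)) ≤
      ((L.choose (m + 1) : ℝ) + (if j ≤ m + 1 then (L.choose (m + 1 - j) : ℝ) else 0)) *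
        ((L.choose m' : ℝ) + (if j ≤ m' then (L.choose (m' - j) : ℝ) else 0)))
    (htot : 0 ≤ ∑ x₁ ∈ range (M₁ + 1), ∑ x₂ ∈ range (M₂ + 1),
        (M₁.choose x₁ : ℝ) * 1 * ((M₂.choose x₂ : ℝ) * 1) *
          (if x₁ + x₂ ≤ K then (L.choose (K - (x₁ + x₂)) : ℝ) else 0) *
          (κ + (2 * (x₁ : ℝ) - M₁) * (2 * (x₂ : ℝ) - M₂))) :
    0 ≤ ∑ x₁ ∈ range (M₁ + 1), ∑ x₂ ∈ range (M₂ + 1),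
        (M₁.choose x₁ : ℝ) * w₁ x₁ * ((M₂.choose x₂ : ℝ) * w₂ x₂) *
          (if x₁ + x₂ ≤ K then (L.choose (K - (x₁ + x₂)) : ℝ) else 0) *
          (κ + (2 * (x₁ : ℝ) - M₁) * (2 * (x₂ : ℝ) - M₂)) := by
  -- Step 1: T(w₁, 1) ≥ 0, using block 2 ∪ buffer (untilted) as the (F, Mo) side.
  have step1 : 0 ≤ ∑ x₁ ∈ range (M₁ + 1), ∑ x₂ ∈ range (M₂ + 1),
      (M₁.choose x₁ : ℝ) * w₁ x₁ * ((M₂.choose x₂ : ℝ) * 1) *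
        (if x₁ + x₂ ≤ K then (L.choose (K - (x₁ + x₂)) : ℝ) else 0) *
        (κ + (2 * (x₁ : ℝ) - M₁) * (2 * (x₂ : ℝ) - M₂)) := by
    rw [triple_comm, outer_form M₂ M₁ L K κ (fun _ => (1 : ℝ)) w₁]
    rw [triple_comm, outer_form M₂ M₁ L K κ (fun _ => (1 : ℝ)) (fun _ => (1 : ℝ))] at htot
    -- lemma_S with block 2 ∪ buffer (weight 1) as the F-side and v = w₁ on block 1
    have h := LemmaS.lemma_S M₁ K κ
      (fun k => ∑ x ∈ range (M₂ + 1), (M₂.choose x : ℝ) *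
        (if x ≤ k then (L.choose (k - x) : ℝ) else 0) * (fun _ : ℕ => (1 : ℝ)) x)
      (fun k => ∑ x ∈ range (M₂ + 1), (M₂.choose x : ℝ) *
        (if x ≤ k then (L.choose (k - x) : ℝ) else 0) * (fun _ : ℕ => (1 : ℝ)) x * (2 * (x : ℝ) - M₂))
      (M₂ + L) j (by omega) hκ
      (fun k hk => CoreBlock.F_eq_zero_of_lt M₂ L _ k hk)
      (fun k hk => F_pos M₂ L _ (fun _ _ => one_pos) (fun _ => zero_le_one) k hk)
      (fun k hk => CoreBlock.Mo_eq_zero_of_lt M₂ L _ k hk)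
      (fun k hk => CoreBlock.F_symm M₂ L _ (fun _ _ => rfl) k hk)
      (fun k hk => CoreBlock.Mo_odd M₂ L _ (fun _ _ => rfl) k hk)
      (fun b => tlm_block M₂ L j _ (fun _ => zero_le_one) hlc b)
      ?_ w₁ hw₁nn hw₁sym hw₁uni
    · simpa using h
    · simpa using htot
  -- Step 2: T(w₁, w₂) ≥ 0, using block 1 ∪ buffer (weight w₁ > 0) as the (F, Mo) side.
  rw [outer_form M₁ M₂ L K κ w₁ w₂]
  rw [outer_form M₁ M₂ L K κ w₁ (fun _ => (1 : ℝ))] at step1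
  have h := LemmaS.lemma_S M₂ K κ
    (fun k => ∑ x ∈ range (M₁ + 1), (M₁.choose x : ℝ) *
      (if x ≤ k then (L.choose (k - x) : ℝ) else 0) * w₁ x)
    (fun k => ∑ x ∈ range (M₁ + 1), (M₁.choose x : ℝ) *
      (if x ≤ k then (L.choose (k - x) : ℝ) else 0) * w₁ x * (2 * (x : ℝ) - M₁))
    (M₁ + L) j (by omega) hκ
    (fun k hk => CoreBlock.F_eq_zero_of_lt M₁ L w₁ k hk)
    (fun k hk => F_pos M₁ L w₁ hw₁pos hw₁nn k hk)
    (fun k hk => CoreBlock.Mo_eq_zero_of_lt M₁ L w₁ k hk)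
    (fun k hk => CoreBlock.F_symm M₁ L w₁ hw₁sym k hk)
    (fun k hk => CoreBlock.Mo_odd M₁ L w₁ hw₁sym k hk)
    (fun b => tlm_block M₁ L j w₁ hw₁nn hlc b)
    (by simpa using step1) w₂ hw₂nn hw₂sym hw₂uni
  simpa using h

/-- **THEOREM U-LC (note §3).**  Let `2K + j = M₁ + M₂ + L`, `κ ≥ 0`, `w₁, w₂ ≥ 0` symmetric unimodal
weights, and suppose `Φ_j(t) = C(L,t) + C(L,t-j)` is two-point log-concave.  If the untilted two-block sum
`T(1,1) = ∑ C(M₁,x₁)C(M₂,x₂)C(L,K-x₁-x₂)(κ + d₁d₂)` is nonnegative, then so is the tilted sum `T(w₁,w₂)`. -/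
theorem u_lc (M₁ M₂ L K j : ℕ) (hN : 2 * K + j = M₁ + M₂ + L) (κ : ℝ) (hκ : 0 ≤ κ)
    (w₁ w₂ : ℕ → ℝ) (hw₁nn : ∀ x, 0 ≤ w₁ x)
    (hw₁sym : ∀ x, x ≤ M₁ → w₁ x = w₁ (M₁ - x)) (hw₁uni : ∀ x, 2 * x + 2 ≤ M₁ → w₁ x ≤ w₁ (x + 1))
    (hw₂nn : ∀ x, 0 ≤ w₂ x)
    (hw₂sym : ∀ x, x ≤ M₂ → w₂ x = w₂ (M₂ - x)) (hw₂uni : ∀ x, 2 * x + 2 ≤ M₂ → w₂ x ≤ w₂ (x + 1))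
    (hlc : ∀ m m', m ≤ m' →
      ((L.choose m : ℝ) + (if j ≤ m then (L.choose (m - j) : ℝ) else 0)) *
        ((L.choose (m' + 1) : ℝ) + (if j ≤ m' + 1 then (L.choose (m' + 1 - j) : ℝ) else 0)) ≤
      ((L.choose (m + 1) : ℝ) + (if j ≤ m + 1 then (L.choose (m + 1 - j) : ℝ) else 0)) *
        ((L.choose m' : ℝ) + (if j ≤ m' then (L.choose (m' - j) : ℝ) else 0)))
    (htot : 0 ≤ ∑ x₁ ∈ range (M₁ + 1), ∑ x₂ ∈ range (M₂ + 1),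
        (M₁.choose x₁ : ℝ) * 1 * ((M₂.choose x₂ : ℝ) * 1) *
          (if x₁ + x₂ ≤ K then (L.choose (K - (x₁ + x₂)) : ℝ) else 0) *
          (κ + (2 * (x₁ : ℝ) - M₁) * (2 * (x₂ : ℝ) - M₂))) :
    0 ≤ ∑ x₁ ∈ range (M₁ + 1), ∑ x₂ ∈ range (M₂ + 1),
        (M₁.choose x₁ : ℝ) * w₁ x₁ * ((M₂.choose x₂ : ℝ) * w₂ x₂) *
          (if x₁ + x₂ ≤ K then (L.choose (K - (x₁ + x₂)) : ℝ) else 0) *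
          (κ + (2 * (x₁ : ℝ) - M₁) * (2 * (x₂ : ℝ) - M₂)) := by
  -- perturb w₁ by ε > 0 and let ε → 0: the sum is affine in ε
  set A := ∑ x₁ ∈ range (M₁ + 1), ∑ x₂ ∈ range (M₂ + 1),
        (M₁.choose x₁ : ℝ) * w₁ x₁ * ((M₂.choose x₂ : ℝ) * w₂ x₂) *
          (if x₁ + x₂ ≤ K then (L.choose (K - (x₁ + x₂)) : ℝ) else 0) *
          (κ + (2 * (x₁ : ℝ) - M₁) * (2 * (x₂ : ℝ) - M₂)) with hA
  set B := ∑ x₁ ∈ range (M₁ + 1), ∑ x₂ ∈ range (M₂ + 1),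
        (M₁.choose x₁ : ℝ) * 1 * ((M₂.choose x₂ : ℝ) * w₂ x₂) *
          (if x₁ + x₂ ≤ K then (L.choose (K - (x₁ + x₂)) : ℝ) else 0) *
          (κ + (2 * (x₁ : ℝ) - M₁) * (2 * (x₂ : ℝ) - M₂)) with hB
  have hε : ∀ ε : ℝ, 0 < ε → 0 ≤ A + ε * B := by
    intro ε hεpos
    have h := u_lc_pos M₁ M₂ L K j hN κ hκ (fun x => w₁ x + ε) w₂
      (fun x _ => by have := hw₁nn x; linarith) (fun x => by have := hw₁nn x; linarith)
      (fun x hx => by rw [hw₁sym x hx]) (fun x hx => by have := hw₁uni x hx; linarith)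
      hw₂nn hw₂sym hw₂uni hlc htot
    have e : ∑ x₁ ∈ range (M₁ + 1), ∑ x₂ ∈ range (M₂ + 1),
        (M₁.choose x₁ : ℝ) * (w₁ x₁ + ε) * ((M₂.choose x₂ : ℝ) * w₂ x₂) *
          (if x₁ + x₂ ≤ K then (L.choose (K - (x₁ + x₂)) : ℝ) else 0) *
          (κ + (2 * (x₁ : ℝ) - M₁) * (2 * (x₂ : ℝ) - M₂)) = A + ε * B := by
      rw [hA, hB, mul_sum, ← sum_add_distrib]
      refine sum_congr rfl fun x₁ _ => ?_
      rw [mul_sum, ← sum_add_distrib]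
      refine sum_congr rfl fun x₂ _ => ?_
      ring
    rw [e] at h
    exact h
  -- an affine function nonnegative for all ε > 0 is nonnegative at 0
  by_contra hneg
  have hAneg : A < 0 := lt_of_not_ge hneg
  rcases le_or_gt B 0 with hB0 | hB0
  · have := hε 1 one_pos
    linarith
  · have hεpos : 0 < -A / (2 * B) := div_pos (by linarith) (by linarith)
    have := hε (-A / (2 * B)) hεpos
    have e : A + -A / (2 * B) * B = A / 2 := by
      field_simp
      ring
    rw [e] at this
    linarith

/-- **U-LC at the centre (j = 0)**, unconditional: the tilted version of TEST(0) for arbitrary symmetric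
unimodal weights.  `Φ_0 = 2C(L,·)` is log-concave (`TwoLevel.phi_lc2_zero`). -/
theorem u_lc_zero (M₁ M₂ L K : ℕ) (hN : 2 * K = M₁ + M₂ + L) (κ : ℝ) (hκ : 0 ≤ κ)
    (w₁ w₂ : ℕ → ℝ) (hw₁nn : ∀ x, 0 ≤ w₁ x)
    (hw₁sym : ∀ x, x ≤ M₁ → w₁ x = w₁ (M₁ - x)) (hw₁uni : ∀ x, 2 * x + 2 ≤ M₁ → w₁ x ≤ w₁ (x + 1))
    (hw₂nn : ∀ x, 0 ≤ w₂ x)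
    (hw₂sym : ∀ x, x ≤ M₂ → w₂ x = w₂ (M₂ - x)) (hw₂uni : ∀ x, 2 * x + 2 ≤ M₂ → w₂ x ≤ w₂ (x + 1))
    (htot : 0 ≤ ∑ x₁ ∈ range (M₁ + 1), ∑ x₂ ∈ range (M₂ + 1),
        (M₁.choose x₁ : ℝ) * 1 * ((M₂.choose x₂ : ℝ) * 1) *
          (if x₁ + x₂ ≤ K then (L.choose (K - (x₁ + x₂)) : ℝ) else 0) *
          (κ + (2 * (x₁ : ℝ) - M₁) * (2 * (x₂ : ℝ) - M₂))) :
    0 ≤ ∑ x₁ ∈ range (M₁ + 1), ∑ x₂ ∈ range (M₂ + 1),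
        (M₁.choose x₁ : ℝ) * w₁ x₁ * ((M₂.choose x₂ : ℝ) * w₂ x₂) *
          (if x₁ + x₂ ≤ K then (L.choose (K - (x₁ + x₂)) : ℝ) else 0) *
          (κ + (2 * (x₁ : ℝ) - M₁) * (2 * (x₂ : ℝ) - M₂)) :=
  u_lc M₁ M₂ L K 0 (by omega) κ hκ w₁ w₂ hw₁nn hw₁sym hw₁uni hw₂nn hw₂sym hw₂uni
    (fun m m' h => TwoLevel.phi_lc2_zero L m m' h) htot

/-- **U-LC one step off the centre (j = 1)**, unconditional: the tilted version of TEST(1) for arbitrary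
symmetric unimodal weights.  `Φ_1 = C(L+1,·)` is log-concave (`TwoLevel.phi_lc2_one`). -/
theorem u_lc_one (M₁ M₂ L K : ℕ) (hN : 2 * K + 1 = M₁ + M₂ + L) (κ : ℝ) (hκ : 0 ≤ κ)
    (w₁ w₂ : ℕ → ℝ) (hw₁nn : ∀ x, 0 ≤ w₁ x)
    (hw₁sym : ∀ x, x ≤ M₁ → w₁ x = w₁ (M₁ - x)) (hw₁uni : ∀ x, 2 * x + 2 ≤ M₁ → w₁ x ≤ w₁ (x + 1))
    (hw₂nn : ∀ x, 0 ≤ w₂ x)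
    (hw₂sym : ∀ x, x ≤ M₂ → w₂ x = w₂ (M₂ - x)) (hw₂uni : ∀ x, 2 * x + 2 ≤ M₂ → w₂ x ≤ w₂ (x + 1))
    (htot : 0 ≤ ∑ x₁ ∈ range (M₁ + 1), ∑ x₂ ∈ range (M₂ + 1),
        (M₁.choose x₁ : ℝ) * 1 * ((M₂.choose x₂ : ℝ) * 1) *
          (if x₁ + x₂ ≤ K then (L.choose (K - (x₁ + x₂)) : ℝ) else 0) *
          (κ + (2 * (x₁ : ℝ) - M₁) * (2 * (x₂ : ℝ) - M₂))) :
    0 ≤ ∑ x₁ ∈ range (M₁ + 1), ∑ x₂ ∈ range (M₂ + 1),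
        (M₁.choose x₁ : ℝ) * w₁ x₁ * ((M₂.choose x₂ : ℝ) * w₂ x₂) *
          (if x₁ + x₂ ≤ K then (L.choose (K - (x₁ + x₂)) : ℝ) else 0) *
          (κ + (2 * (x₁ : ℝ) - M₁) * (2 * (x₂ : ℝ) - M₂)) :=
  u_lc M₁ M₂ L K 1 hN κ hκ w₁ w₂ hw₁nn hw₁sym hw₁uni hw₂nn hw₂sym hw₂uni
    (fun m m' h => TwoLevel.phi_lc2_one L m m' h) htot

end ULC

end Summit.CriticalPhenomena.PercolationContinuityZ3.Theorems
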